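import Summits.QuantumFields.BalabanUV.T4Continuum.Support.NE3TangentCovariantStructure
import Summits.QuantumFields.BalabanUV.T4Continuum.Support.NE3TangentFlatStructure
import HarnessLib

/-!
# T⁴ programme, node NE3 — THE COVARIANT STRUCTURE THEOREM OF THE k-FOLD LINEARISED AVERAGE AT A SMALL-FIELD BACKGROUND:
# `dirIter L k W Y = QbarIter L k W Y + gaugeDir (cavgIter L k W) (framePotW L k W Y)` — THE FRAMES ARE COARSE GAUGE DIRECTIONS

NE3 formalisation swarm `b2b-balaban-t4-ne3-formalise-*`, LEAF PROVER 04 (gen 4), sub-row **E-MLw-w4-S** file 2∕2 (INTENT in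
HOME/CLAIMS.log, 2026-08-20 ≈14:08Z) under the (w4) CORE of `t4/formal/NE3/LEAVES.md` row E-MLw-w4 (owner `t4-ne3-p1-g20`, «claimable
by INTENT», CLAIMS.log l.14083).  The tower over file 1 `NE3TangentCovariantStructure` (one level: `cpush = Qbar + gaugeDir (cavg W) Fbar`,
`cpush (gaugeDir W λ) = gaugeDir (cavg W) (λ ∘ L•)`, additivity∕skewness∕periodicity of the coarse readings) — the covariant twin
of this unit's file (A) `NE3TangentFlatStructure` (p219035, `W = 1`: `(Tcoarse L)^[k] Y = (Qcoarse L)^[k] Y − dPot (framePot L k Y)`).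

CONTENT (all [folklore]; 0 sorry; DATA defs `dirIter`, `QbarIter`, `framePotW` by structural recursion, inner-first like the tree's
`cavgIter`∕`TangentIter` → async audit; no `def … : Prop`):
§1 the k-fold linearised average `dirIter` (`dirIter 0 W Y = Y`, `dirIter (j+1) W Y = dirIter j (cavg W) (cpush W Y)`), the k-fold
   double-bar average `QbarIter`, the accumulated frame generator `framePotW`; outer forms (`cavgIter_succ'`, `dirIter_succ'`,
   `QbarIter_succ'`, `framePotW_succ'`); **`tangentIter_iff_dirIter_eq_zero`**: `TangentIter L j W Y ↔ dirIter L (j+1) W Y = 0` (rfl-level);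
§2 the tower: `dirIter_add` (additivity through the small-field tower), **`dirIter_gaugeDir`** (`dirIter (j+1) W (gaugeDir W λ) =
   gaugeDir (cavgIter (j+1) W) (λ ∘ L^{j+1}•)` — gauge directions stay gauge directions through the whole tower, EXACTLY),
   **`dirIter_eq_QbarIter_add_gaugeDir`** (the structure theorem) and its tangent-space reading
   **`QbarIter_eq_neg_gaugeDir_of_tangentIter`** ∕ `tangentIter_of_QbarIter_eq_neg_gaugeDir`: on `T(W) = ker d(avgIter (j+1))(W)` the
   k-fold covariant double-bar average IS the coarse gauge direction generated by (minus) the accumulated frames;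
   `dirIter_add_gaugeDir` (adding `gaugeDir W μ` shifts the k-fold average by the coarse gauge direction of `μ ∘ L^{j+1}•`) and
   `tangentIter_add_gaugeDir_iff` (generators vanishing at the block corners preserve tangency);
§3 the flat check BY NAME against file (A): `cavgIter_flat`, `dirIter_flat = (Tcoarse L)^[j]`, `Qbar_flat = Qcoarse`,
   `QbarIter_flat = (Qcoarse L)^[j]`, `Fbar_flat = Fcoarse`, `framePotW_flat = framePot`, `gaugeDir_flat = −dPot`.

HYPOTHESES of §2 are the tree's multi-level small-field class (`AveragingDeficitMultiLevelPrep`: unitary `W` of period `tower L M (j+1)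
= L^{j+1}·M`, `LevelSmall d L j x`, `SmallField W x`) and skew periodic `Y`; every averaging step is the tree's B7 Prop. 1
(`cavg_isUnitaryCfg`, `smallField_cavg`) exactly as in `AveragingDeficitMultiLevelPrep.levelQ'_resDir_eq_zero`.

WHY (honest).  This reduces the open (w4) core «(P_W) at W = cavg L U_B» to a statement about directions whose covariant straight
k-fold average is a coarse gauge direction, with the generator EXPLICIT — as (A) did at `W = 1` for rows w3 (p219635∕p219822).  The
Poincaré half at a curved background is NOT claimed here (located small divisor: CLAIMS.log INTENT line, leaf-02-g4's N-ne3leaf02g4-1).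
Nothing about Bałaban's minimisers, (P_W), (ML_w), T-E_w or NE3 is asserted; NE3 NOT proved; spine 0∕9; finite T⁴ rung (B)+1 — NOT
infinite volume, NOT mass gap, NOT BetaPertH, NOT Clay.  ABSOLUTE RULE kept (context: [Balaban1985Averaging] (42)–(45) pp. 23–24,
(110)–(125) pp. 31–36; [Balaban1985Variational] (83) p. 290).  PLACEMENT: `Summits/QuantumFields/BalabanUV/`.
-/

set_option autoImplicit false

open scoped BigOperators Matrix.Norms.L2Operator
open Finset

namespace Summit.QuantumFields.BalabanUV.T4Continuum.NE3TangentCovariantTower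

open Literature.MathematicalPhysics.QuantumFieldTheory.Balaban1983to89
open B7Prop1Explicit B7Prop2Explicit
open T4AveragingDeficitWall (IsUnitaryCfg IsSkewDir SmallField Ad)
open T4AveragingDeficitWallBoundary (IsPeriodicCfg)
open AveragingDeficitPeriodicCounting (IsPeriodicDir)
open AveragingDeficitChartCalculus (cavg)
open AveragingDeficitMultiLevelPrep (cpush cavgIter TangentIter tower LevelSmall natCast_tower_succ tower_ne_zero)
open AveragingDeficitTwoLevelPrep (twoLevelSmall prop1Radius smallness_of_twoLevelSmall cavg_isUnitaryCfg smallField_cavg)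
open AveragingDeficitFermat (isPeriodicCfg_cavg small512_of_liftSmall)
open BlockAveragePushDirGauge (gaugeDir)
open BlockAveragePushDirSplit (flat frameLin_flat dbarLin_flat)
open SmoothRefineNeutral (Tcoarse)
open NE3TangentNoGoWords (dPot)
open NE3TangentNoGoFlat (cpush_flat cavg_flat)
open NE3TangentFlatStructure (Qcoarse Fcoarse framePot)
open NE3TangentCovariantStructure

noncomputable section

variable {d : ℕ} {n : Type*} [Fintype n] [DecidableEq n]

local notation "𝕄" => Matrix n n ℂ

/-! ## §1 The k-fold linearised average, the k-fold double-bar average, the accumulated frames -/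

/-- THE k-FOLD LINEARISED AVERAGE read on the unit lattices (inner-first, like `cavgIter`∕`TangentIter`): `dirIter L 0 W Y = Y`,
`dirIter L (j+1) W Y = dirIter L j (cavg L W) (cpush L W Y)` — the differential of B7's k-fold average (42) at `W` applied to `Y`.
[cite: Balaban1985Averaging, (42) p.23] -/
def dirIter (L : ℕ) : ℕ → (Site d → Fin d → 𝕄ˣ) → (Site d → Fin d → 𝕄) → Site d → Fin d → 𝕄
  | 0, _, Y => Y
  | j + 1, W, Y => dirIter L j (cavg L W) (cpush L W Y)

/-- THE k-FOLD LINEARISED DOUBLE-BAR AVERAGE: `QbarIter L 0 W Y = Y`, `QbarIter L (j+1) W Y = QbarIter L j (cavg L W) (Qbar L W Y)`.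
[cite: Balaban1985Averaging, (120) p.35] -/
def QbarIter (L : ℕ) : ℕ → (Site d → Fin d → 𝕄ˣ) → (Site d → Fin d → 𝕄) → Site d → Fin d → 𝕄
  | 0, _, Y => Y
  | j + 1, W, Y => QbarIter L j (cavg L W) (Qbar L W Y)

/-- THE ACCUMULATED FRAME GENERATOR of the k-fold average: `framePotW L 0 W Y = 0`,
`framePotW L (j+1) W Y z = framePotW L j (cavg L W) (Qbar L W Y) z + Fbar L W Y (L^j • z)`. [cite: Balaban1985Averaging, (112) p.34] -/
def framePotW (L : ℕ) : ℕ → (Site d → Fin d → 𝕄ˣ) → (Site d → Fin d → 𝕄) → Site d → 𝕄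
  | 0, _, _ => fun _ => 0
  | j + 1, W, Y => fun z => framePotW L j (cavg L W) (Qbar L W Y) z + Fbar L W Y (((L : ℤ) ^ j) • z)

/-- `dirIter L 0 W Y = Y`. [folklore] -/
theorem dirIter_zero (L : ℕ) (W : Site d → Fin d → 𝕄ˣ) (Y : Site d → Fin d → 𝕄) : dirIter L 0 W Y = Y := rfl

/-- `dirIter L (j+1) W Y = dirIter L j (cavg L W) (cpush L W Y)`. [folklore] -/
theorem dirIter_succ (L j : ℕ) (W : Site d → Fin d → 𝕄ˣ) (Y : Site d → Fin d → 𝕄) :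
    dirIter L (j + 1) W Y = dirIter L j (cavg L W) (cpush L W Y) := rfl

/-- `dirIter L 1 W Y = cpush L W Y`. [folklore] -/
theorem dirIter_one (L : ℕ) (W : Site d → Fin d → 𝕄ˣ) (Y : Site d → Fin d → 𝕄) : dirIter L 1 W Y = cpush L W Y := rfl

/-- `QbarIter L 0 W Y = Y`. [folklore] -/
theorem QbarIter_zero (L : ℕ) (W : Site d → Fin d → 𝕄ˣ) (Y : Site d → Fin d → 𝕄) : QbarIter L 0 W Y = Y := rfl

/-- `QbarIter L (j+1) W Y = QbarIter L j (cavg L W) (Qbar L W Y)`. [folklore] -/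
theorem QbarIter_succ (L j : ℕ) (W : Site d → Fin d → 𝕄ˣ) (Y : Site d → Fin d → 𝕄) :
    QbarIter L (j + 1) W Y = QbarIter L j (cavg L W) (Qbar L W Y) := rfl

/-- `QbarIter L 1 W Y = Qbar L W Y`. [folklore] -/
theorem QbarIter_one (L : ℕ) (W : Site d → Fin d → 𝕄ˣ) (Y : Site d → Fin d → 𝕄) : QbarIter L 1 W Y = Qbar L W Y := rfl

/-- `cavgIter L (i+1) W = cavgIter L i (cavg L W)` (the tree's recursion, as a rewrite rule). [folklore] -/
theorem cavgIter_succ (L i : ℕ) (W : Site d → Fin d → 𝕄ˣ) : cavgIter L (i + 1) W = cavgIter L i (cavg L W) := rfl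

/-- `cavgIter L 1 W = cavg L W`. [folklore] -/
theorem cavgIter_one (L : ℕ) (W : Site d → Fin d → 𝕄ˣ) : cavgIter L 1 W = cavg L W := rfl

/-- `framePotW L 0 W Y = 0`. [folklore] -/
theorem framePotW_zero (L : ℕ) (W : Site d → Fin d → 𝕄ˣ) (Y : Site d → Fin d → 𝕄) : framePotW L 0 W Y = fun _ => 0 := rfl

/-- `framePotW L (j+1) W Y = framePotW L j (cavg L W) (Qbar L W Y) + Fbar L W Y ∘ (L^j•)`. [folklore] -/
theorem framePotW_succ (L j : ℕ) (W : Site d → Fin d → 𝕄ˣ) (Y : Site d → Fin d → 𝕄) :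
    framePotW L (j + 1) W Y = fun z => framePotW L j (cavg L W) (Qbar L W Y) z + Fbar L W Y (((L : ℤ) ^ j) • z) := rfl

/-- `framePotW L 1 W Y = Fbar L W Y`. [folklore] -/
theorem framePotW_one (L : ℕ) (W : Site d → Fin d → 𝕄ˣ) (Y : Site d → Fin d → 𝕄) : framePotW L 1 W Y = Fbar L W Y := by
  rw [framePotW_succ]
  funext z
  rw [framePotW_zero, pow_zero, one_smul, zero_add]

/-- Outer form of the iterated average: `cavgIter L (j+1) W = cavg L (cavgIter L j W)`. [folklore] -/
theorem cavgIter_succ' (L : ℕ) : ∀ (j : ℕ) (W : Site d → Fin d → 𝕄ˣ), cavgIter L (j + 1) W = cavg L (cavgIter L j W)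
  | 0, _ => rfl
  | j + 1, W => cavgIter_succ' L j (cavg L W)

/-- Outer form of the k-fold linearised average: `dirIter L (j+1) W Y = cpush L (cavgIter L j W) (dirIter L j W Y)`. [folklore] -/
theorem dirIter_succ' (L : ℕ) : ∀ (j : ℕ) (W : Site d → Fin d → 𝕄ˣ) (Y : Site d → Fin d → 𝕄),
    dirIter L (j + 1) W Y = cpush L (cavgIter L j W) (dirIter L j W Y)
  | 0, _, _ => rfl
  | j + 1, W, Y => dirIter_succ' L j (cavg L W) (cpush L W Y)

/-- Outer form of the k-fold double-bar average: `QbarIter L (j+1) W Y = Qbar L (cavgIter L j W) (QbarIter L j W Y)`. [folklore] -/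
theorem QbarIter_succ' (L : ℕ) : ∀ (j : ℕ) (W : Site d → Fin d → 𝕄ˣ) (Y : Site d → Fin d → 𝕄),
    QbarIter L (j + 1) W Y = Qbar L (cavgIter L j W) (QbarIter L j W Y)
  | 0, _, _ => rfl
  | j + 1, W, Y => QbarIter_succ' L j (cavg L W) (Qbar L W Y)

/-- Outer form of the accumulated frames: `framePotW L (j+1) W Y z = Fbar L (cavgIter L j W) (QbarIter L j W Y) z + framePotW L j W Y (L•z)`
(the recursion of file (A)'s `framePot`). [folklore] -/
theorem framePotW_succ' (L : ℕ) : ∀ (j : ℕ) (W : Site d → Fin d → 𝕄ˣ) (Y : Site d → Fin d → 𝕄) (z : Site d),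
    framePotW L (j + 1) W Y z = Fbar L (cavgIter L j W) (QbarIter L j W Y) z + framePotW L j W Y ((L : ℤ) • z)
  | 0, W, Y, z => by
      show (0 : 𝕄) + Fbar L W Y (((L : ℤ) ^ 0) • z) = Fbar L W Y z + 0
      rw [pow_zero, one_smul, zero_add, add_zero]
  | j + 1, W, Y, z => by
      show framePotW L (j + 1) (cavg L W) (Qbar L W Y) z + Fbar L W Y (((L : ℤ) ^ (j + 1)) • z)
          = Fbar L (cavgIter L j (cavg L W)) (QbarIter L j (cavg L W) (Qbar L W Y)) z
            + (framePotW L j (cavg L W) (Qbar L W Y) ((L : ℤ) • z) + Fbar L W Y (((L : ℤ) ^ j) • ((L : ℤ) • z)))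
      rw [framePotW_succ' L j (cavg L W) (Qbar L W Y) z, smul_smul, ← pow_succ, add_assoc]

/-- **TANGENCY IS THE VANISHING OF THE k-FOLD LINEARISED AVERAGE**: `TangentIter L j W Y ↔ dirIter L (j+1) W Y = 0` (both recursions
are inner-first; definitional). [cite: Balaban1985Variational, (83) p.290] -/
theorem tangentIter_iff_dirIter_eq_zero (L : ℕ) : ∀ (j : ℕ) (W : Site d → Fin d → 𝕄ˣ) (Y : Site d → Fin d → 𝕄),
    TangentIter L j W Y ↔ dirIter L (j + 1) W Y = 0
  | 0, _, _ => Iff.rfl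
  | j + 1, W, Y => tangentIter_iff_dirIter_eq_zero L j (cavg L W) (cpush L W Y)

/-! ## §2 The tower: additivity, gauge directions stay gauge directions, the structure theorem -/

/-- One B7 Prop. 1 step of the small-field tower (the tree's `cavg_isUnitaryCfg`∕`smallField_cavg` packaged): the `512`-smallness of
the current level and unitarity, non-negativity of the radius and small-field of the next. [cite: Balaban1985Averaging, Prop. 1 p.24] -/
theorem step_small [Nonempty n] {L : ℕ} (hL : 1 ≤ L) {W : Site d → Fin d → 𝕄ˣ} (hWu : IsUnitaryCfg W) {x : ℝ} (hx : 0 ≤ x)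
    (hs : twoLevelSmall d L * x ≤ 1) (hWx : SmallField W x) :
    512 * (d + 1) * (d + 4) * (L : ℝ) ^ 2 * x ≤ 1 ∧ IsUnitaryCfg (cavg L W) ∧ 0 ≤ prop1Radius d L x
      ∧ SmallField (cavg L W) (prop1Radius d L x) := by
  obtain ⟨hlift, hr0, -, -⟩ := smallness_of_twoLevelSmall (d := d) hL hx hs
  have h512 := small512_of_liftSmall hL hx hlift
  exact ⟨h512, cavg_isUnitaryCfg hL hWu hx h512 hWx, hr0, smallField_cavg hL hWu hx h512 hWx⟩

/-- **ADDITIVITY THROUGH THE TOWER**: in the multi-level small-field class, `dirIter L (j+1) W (A + B) = dirIter L (j+1) W A + dirIter L (j+1) W B`.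
[folklore] -/
theorem dirIter_add [Nonempty n] {L : ℕ} (hL : 1 ≤ L) (j : ℕ) :
    ∀ {W : Site d → Fin d → 𝕄ˣ} {x : ℝ}, IsUnitaryCfg W → 0 ≤ x → LevelSmall d L j x → SmallField W x →
    ∀ (A B : Site d → Fin d → 𝕄),
      dirIter L (j + 1) W (fun y μ => A y μ + B y μ) = fun z κ => dirIter L (j + 1) W A z κ + dirIter L (j + 1) W B z κ := by
  induction j with
  | zero =>
      intro W x hWu hx hs hWx A B
      obtain ⟨h512, -, -, -⟩ := step_small hL hWu hx hs hWx
      exact cpush_add hL hWu hx h512 hWx A B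
  | succ j ih =>
      intro W x hWu hx hs hWx A B
      obtain ⟨h512, hW₁u, hr0, hW₁x⟩ := step_small hL hWu hx hs.1 hWx
      show dirIter L (j + 1) (cavg L W) (cpush L W (fun y μ => A y μ + B y μ)) = fun z κ =>
          dirIter L (j + 1) (cavg L W) (cpush L W A) z κ + dirIter L (j + 1) (cavg L W) (cpush L W B) z κ
      rw [cpush_add hL hWu hx h512 hWx A B]
      exact ih hW₁u hr0 hs.2 hW₁x _ _

/-- **GAUGE DIRECTIONS STAY GAUGE DIRECTIONS THROUGH THE WHOLE TOWER, EXACTLY**: for a unitary `W` of period `L^{j+1}·M` in the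
multi-level small-field class and a skew `L^{j+1}·M`-periodic generator `λ`,
`dirIter L (j+1) W (gaugeDir W λ) = gaugeDir (cavgIter L (j+1) W) (λ ∘ L^{j+1}•)` (file 1's `cpush_gaugeDir` at every level).
[cite: Balaban1985Averaging, (45) p.24] -/
theorem dirIter_gaugeDir [Nonempty n] {L M : ℕ} [NeZero M] (hL : 1 ≤ L) (j : ℕ) :
    ∀ {W : Site d → Fin d → 𝕄ˣ} {x : ℝ}, IsUnitaryCfg W → IsPeriodicCfg W ((tower L M (j + 1) : ℕ) : ℤ) → 0 ≤ x →
    LevelSmall d L j x → SmallField W x → ∀ {lam : Site d → 𝕄}, (∀ x, lam x ∈ skewAdjoint 𝕄) →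
    (∀ (y : Site d) (i : Fin d), lam (y + ((tower L M (j + 1) : ℕ) : ℤ) • e i) = lam y) →
      dirIter L (j + 1) W (gaugeDir W lam) = gaugeDir (cavgIter L (j + 1) W) (fun y => lam (((L : ℤ) ^ (j + 1)) • y)) := by
  haveI : NeZero L := ⟨by omega⟩
  induction j with
  | zero =>
      intro W x hWu hWP hx hs hWx lam hlam hlamP
      haveI : NeZero (L * M) := ⟨Nat.mul_ne_zero (NeZero.ne L) (NeZero.ne M)⟩
      obtain ⟨h512, -, -, -⟩ := step_small hL hWu hx hs hWx
      show cpush L W (gaugeDir W lam) = gaugeDir (cavg L W) (fun y => lam (((L : ℤ) ^ (0 + 1)) • y))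
      simp only [zero_add, pow_one]
      exact cpush_gaugeDir (M := M) hL hWu hWP hx h512 hWx hlam hlamP
  | succ j ih =>
      intro W x hWu hWP hx hs hWx lam hlam hlamP
      haveI : NeZero (L * tower L M (j + 1)) := ⟨tower_ne_zero L M (j + 2)⟩
      obtain ⟨h512, hW₁u, hr0, hW₁x⟩ := step_small hL hWu hx hs.1 hWx
      have hWP' : IsPeriodicCfg W ((L : ℤ) * (tower L M (j + 1) : ℕ)) := by rw [← natCast_tower_succ]; exact hWP
      have hW₁P : IsPeriodicCfg (cavg L W) ((tower L M (j + 1) : ℕ) : ℤ) := isPeriodicCfg_cavg L _ hWP'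
      have hlam₁ : ∀ y, (fun y => lam ((L : ℤ) • y)) y ∈ skewAdjoint 𝕄 := fun y => hlam _
      have hlam₁P : ∀ (y : Site d) (i : Fin d),
          (fun y => lam ((L : ℤ) • y)) (y + ((tower L M (j + 1) : ℕ) : ℤ) • e i) = (fun y => lam ((L : ℤ) • y)) y := by
        intro y i
        simp only [smul_add, smul_smul, ← natCast_tower_succ]
        exact hlamP _ i
      show dirIter L (j + 1) (cavg L W) (cpush L W (gaugeDir W lam))
          = gaugeDir (cavgIter L (j + 1) (cavg L W)) (fun y => lam (((L : ℤ) ^ (j + 1 + 1)) • y))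
      rw [cpush_gaugeDir (M := tower L M (j + 1)) hL hWu hWP hx h512 hWx hlam hlamP,
        ih hW₁u hW₁P hr0 hs.2 hW₁x hlam₁ hlam₁P, comp_smul_smul]

/-- **THE COVARIANT STRUCTURE THEOREM OF THE k-FOLD LINEARISED AVERAGE**: for a unitary `W` of period `L^{j+1}·M` in the multi-level
small-field class and a skew `L^{j+1}·M`-periodic direction `Y`,
`dirIter L (j+1) W Y = QbarIter L (j+1) W Y + gaugeDir (cavgIter L (j+1) W) (framePotW L (j+1) W Y)` — the k-fold linearised average is
the k-fold covariant double-bar average plus the COARSE GAUGE DIRECTION generated by the accumulated linearised frames (B7 (110)∕(120)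
TYPE, linearised and iterated; at `W = 1` this is file (A)'s `iterate_Tcoarse_eq`, see §3). [cite: Balaban1985Averaging, (110)–(120) pp.31–35] -/
theorem dirIter_eq_QbarIter_add_gaugeDir [Nonempty n] {L M : ℕ} [NeZero M] (hL : 1 ≤ L) (j : ℕ) :
    ∀ {W : Site d → Fin d → 𝕄ˣ} {x : ℝ}, IsUnitaryCfg W → IsPeriodicCfg W ((tower L M (j + 1) : ℕ) : ℤ) → 0 ≤ x →
    LevelSmall d L j x → SmallField W x → ∀ {Y : Site d → Fin d → 𝕄}, IsSkewDir Y →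
    IsPeriodicDir Y ((tower L M (j + 1) : ℕ) : ℤ) →
      dirIter L (j + 1) W Y
        = fun z κ => QbarIter L (j + 1) W Y z κ + gaugeDir (cavgIter L (j + 1) W) (framePotW L (j + 1) W Y) z κ := by
  haveI : NeZero L := ⟨by omega⟩
  induction j with
  | zero =>
      intro W x _ _ _ _ _ Y _ _
      rw [zero_add, dirIter_one, QbarIter_one, cavgIter_one, framePotW_one]
      funext z κ
      exact cpush_eq_Qbar_add_gaugeDir L W Y z κ
  | succ j ih =>
      intro W x hWu hWP hx hs hWx Y hY hYP
      obtain ⟨h512, hW₁u, hr0, hW₁x⟩ := step_small hL hWu hx hs.1 hWx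
      have hWP' : IsPeriodicCfg W ((L : ℤ) * (tower L M (j + 1) : ℕ)) := by rw [← natCast_tower_succ]; exact hWP
      have hYP' : IsPeriodicDir Y ((L : ℤ) * (tower L M (j + 1) : ℕ)) := by rw [← natCast_tower_succ]; exact hYP
      have hW₁P : IsPeriodicCfg (cavg L W) ((tower L M (j + 1) : ℕ) : ℤ) := isPeriodicCfg_cavg L _ hWP'
      have hQu : IsSkewDir (Qbar L W Y) := Qbar_skew hL hWu hx h512 hWx hY
      have hQP : IsPeriodicDir (Qbar L W Y) ((tower L M (j + 1) : ℕ) : ℤ) := fun z i κ => Qbar_add_period L hWP' hYP' z i κ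
      have hFs : ∀ z, Fbar L W Y z ∈ skewAdjoint 𝕄 := fun z => Fbar_skew L hWu hY z
      have hFP : ∀ (z : Site d) (i : Fin d), Fbar L W Y (z + ((tower L M (j + 1) : ℕ) : ℤ) • e i) = Fbar L W Y z :=
        fun z i => Fbar_add_period L hWP' hYP' z i
      have hsplit : cpush L W Y = fun y μ => Qbar L W Y y μ + gaugeDir (cavg L W) (Fbar L W Y) y μ := by
        funext y μ; exact cpush_eq_Qbar_add_gaugeDir L W Y y μ
      have e1 := dirIter_add hL j hW₁u hr0 hs.2 hW₁x (Qbar L W Y) (gaugeDir (cavg L W) (Fbar L W Y))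
      have e2 := ih hW₁u hW₁P hr0 hs.2 hW₁x hQu hQP
      have e3 := dirIter_gaugeDir hL j hW₁u hW₁P hr0 hs.2 hW₁x hFs hFP
      rw [dirIter_succ L (j + 1) W Y, QbarIter_succ L (j + 1) W Y, cavgIter_succ L (j + 1) W, framePotW_succ L (j + 1) W Y,
        hsplit, e1, e2, e3]
      funext z κ
      beta_reduce
      rw [gaugeDir_add_fun, add_assoc]

/-- **THE TANGENT SPACE IS WHERE THE k-FOLD DOUBLE-BAR AVERAGE IS A COARSE GAUGE DIRECTION**: under the hypotheses of the structure
theorem, `TangentIter L j W Y` implies `QbarIter L (j+1) W Y = − gaugeDir (cavgIter L (j+1) W) (framePotW L (j+1) W Y)`.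
[cite: Balaban1985Variational, (83) p.290] -/
theorem QbarIter_eq_neg_gaugeDir_of_tangentIter [Nonempty n] {L M : ℕ} [NeZero M] (hL : 1 ≤ L) (j : ℕ)
    {W : Site d → Fin d → 𝕄ˣ} {x : ℝ} (hWu : IsUnitaryCfg W) (hWP : IsPeriodicCfg W ((tower L M (j + 1) : ℕ) : ℤ)) (hx : 0 ≤ x)
    (hs : LevelSmall d L j x) (hWx : SmallField W x) {Y : Site d → Fin d → 𝕄} (hY : IsSkewDir Y)
    (hYP : IsPeriodicDir Y ((tower L M (j + 1) : ℕ) : ℤ)) (hT : TangentIter L j W Y) :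
    QbarIter L (j + 1) W Y = fun z κ => -gaugeDir (cavgIter L (j + 1) W) (framePotW L (j + 1) W Y) z κ := by
  have h0 : dirIter L (j + 1) W Y = 0 := (tangentIter_iff_dirIter_eq_zero L j W Y).1 hT
  have h := dirIter_eq_QbarIter_add_gaugeDir (M := M) hL j hWu hWP hx hs hWx hY hYP
  rw [h0] at h
  funext z κ
  have hz : QbarIter L (j + 1) W Y z κ + gaugeDir (cavgIter L (j + 1) W) (framePotW L (j + 1) W Y) z κ = 0 := by
    have := congr_fun (congr_fun h z) κ
    simpa using this.symm
  exact eq_neg_of_add_eq_zero_left hz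

/-- Conversely, `QbarIter L (j+1) W Y = − gaugeDir (cavgIter L (j+1) W) (framePotW L (j+1) W Y)` implies `TangentIter L j W Y`. [folklore] -/
theorem tangentIter_of_QbarIter_eq_neg_gaugeDir [Nonempty n] {L M : ℕ} [NeZero M] (hL : 1 ≤ L) (j : ℕ)
    {W : Site d → Fin d → 𝕄ˣ} {x : ℝ} (hWu : IsUnitaryCfg W) (hWP : IsPeriodicCfg W ((tower L M (j + 1) : ℕ) : ℤ)) (hx : 0 ≤ x)
    (hs : LevelSmall d L j x) (hWx : SmallField W x) {Y : Site d → Fin d → 𝕄} (hY : IsSkewDir Y)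
    (hYP : IsPeriodicDir Y ((tower L M (j + 1) : ℕ) : ℤ))
    (hQ : QbarIter L (j + 1) W Y = fun z κ => -gaugeDir (cavgIter L (j + 1) W) (framePotW L (j + 1) W Y) z κ) :
    TangentIter L j W Y := by
  rw [tangentIter_iff_dirIter_eq_zero, dirIter_eq_QbarIter_add_gaugeDir (M := M) hL j hWu hWP hx hs hWx hY hYP, hQ]
  funext z κ
  simp only [Pi.zero_apply, neg_add_cancel]

/-- **ADDING A GAUGE DIRECTION SHIFTS THE k-FOLD AVERAGE BY A COARSE GAUGE DIRECTION**: in the multi-level small-field class,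
for a skew `L^{j+1}·M`-periodic generator `μ`, `dirIter L (j+1) W (Y + gaugeDir W μ) = dirIter L (j+1) W Y + gaugeDir (cavgIter L (j+1) W) (μ ∘ L^{j+1}•)`
(`dirIter_add` + `dirIter_gaugeDir`). [cite: Balaban1985Averaging, (45) p.24] -/
theorem dirIter_add_gaugeDir [Nonempty n] {L M : ℕ} [NeZero M] (hL : 1 ≤ L) (j : ℕ) {W : Site d → Fin d → 𝕄ˣ} {x : ℝ}
    (hWu : IsUnitaryCfg W) (hWP : IsPeriodicCfg W ((tower L M (j + 1) : ℕ) : ℤ)) (hx : 0 ≤ x) (hs : LevelSmall d L j x)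
    (hWx : SmallField W x) (Y : Site d → Fin d → 𝕄) {mu : Site d → 𝕄} (hmu : ∀ x, mu x ∈ skewAdjoint 𝕄)
    (hmuP : ∀ (y : Site d) (i : Fin d), mu (y + ((tower L M (j + 1) : ℕ) : ℤ) • e i) = mu y) :
    dirIter L (j + 1) W (fun y ν => Y y ν + gaugeDir W mu y ν)
      = fun z κ => dirIter L (j + 1) W Y z κ + gaugeDir (cavgIter L (j + 1) W) (fun y => mu (((L : ℤ) ^ (j + 1)) • y)) z κ := by
  rw [dirIter_add hL j hWu hx hs hWx Y (gaugeDir W mu), dirIter_gaugeDir (M := M) hL j hWu hWP hx hs hWx hmu hmuP]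

/-- **GENERATORS VANISHING AT THE BLOCK CORNERS PRESERVE TANGENCY**: if moreover `μ (L^{j+1}•z) = 0` for every coarse site `z`, then
`TangentIter L j W (Y + gaugeDir W μ) ↔ TangentIter L j W Y` — the linearised gauge orbit through the tangent space, cut by the
corner condition, stays in the tangent space (the freedom a Landau-type clause fixes). [cite: Balaban1985Variational, (83) p.290] -/
theorem tangentIter_add_gaugeDir_iff [Nonempty n] {L M : ℕ} [NeZero M] (hL : 1 ≤ L) (j : ℕ) {W : Site d → Fin d → 𝕄ˣ} {x : ℝ}
    (hWu : IsUnitaryCfg W) (hWP : IsPeriodicCfg W ((tower L M (j + 1) : ℕ) : ℤ)) (hx : 0 ≤ x) (hs : LevelSmall d L j x)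
    (hWx : SmallField W x) (Y : Site d → Fin d → 𝕄) {mu : Site d → 𝕄} (hmu : ∀ x, mu x ∈ skewAdjoint 𝕄)
    (hmuP : ∀ (y : Site d) (i : Fin d), mu (y + ((tower L M (j + 1) : ℕ) : ℤ) • e i) = mu y)
    (hmu0 : ∀ z : Site d, mu (((L : ℤ) ^ (j + 1)) • z) = 0) :
    TangentIter L j W (fun y ν => Y y ν + gaugeDir W mu y ν) ↔ TangentIter L j W Y := by
  have hg : gaugeDir (cavgIter L (j + 1) W) (fun y => mu (((L : ℤ) ^ (j + 1)) • y)) = 0 := by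
    funext z κ
    simp only [gaugeDir, hmu0, Ad, Pi.zero_apply, mul_zero, zero_mul, sub_zero]
  rw [tangentIter_iff_dirIter_eq_zero, tangentIter_iff_dirIter_eq_zero,
    dirIter_add_gaugeDir (M := M) hL j hWu hWP hx hs hWx Y hmu hmuP, hg]
  constructor
  · intro h
    funext z κ
    have := congr_fun (congr_fun h z) κ
    simpa using this
  · intro h
    funext z κ
    simp [h]

/-! ## §3 The flat check: at `W = 1` this is file (A) by name -/

/-- `cavgIter L j 1 = 1`. [folklore] -/
theorem cavgIter_flat (L : ℕ) : ∀ j : ℕ, cavgIter L j (flat (d := d) (n := n)) = flat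
  | 0 => rfl
  | j + 1 => by
      show cavgIter L j (cavg L flat) = flat
      rw [cavg_flat]; exact cavgIter_flat L j

/-- `dirIter L j 1 Y = (Tcoarse L)^[j] Y` (`NE3TangentNoGoFlat.cpush_flat` iterated). [folklore] -/
theorem dirIter_flat {L : ℕ} (hL : 1 ≤ L) : ∀ (j : ℕ) (Y : Site d → Fin d → 𝕄), dirIter L j (flat (d := d) (n := n)) Y = (Tcoarse L)^[j] Y
  | 0, _ => rfl
  | j + 1, Y => by
      show dirIter L j (cavg L flat) (cpush L flat Y) = (Tcoarse L)^[j + 1] Y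
      rw [cavg_flat, cpush_flat L hL, Function.iterate_succ_apply]
      exact dirIter_flat hL j _

/-- `Qbar L 1 Y = Qcoarse L Y` (`BlockAveragePushDirSplit.dbarLin_flat`). [folklore] -/
theorem Qbar_flat {L : ℕ} (hL : 1 ≤ L) (Y : Site d → Fin d → 𝕄) : Qbar L (flat (d := d) (n := n)) Y = Qcoarse L Y := by
  funext z κ
  exact dbarLin_flat L hL Y _ κ

/-- `QbarIter L j 1 Y = (Qcoarse L)^[j] Y`. [folklore] -/
theorem QbarIter_flat {L : ℕ} (hL : 1 ≤ L) : ∀ (j : ℕ) (Y : Site d → Fin d → 𝕄), QbarIter L j (flat (d := d) (n := n)) Y = (Qcoarse L)^[j] Y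
  | 0, _ => rfl
  | j + 1, Y => by
      show QbarIter L j (cavg L flat) (Qbar L flat Y) = (Qcoarse L)^[j + 1] Y
      rw [cavg_flat, Qbar_flat hL, Function.iterate_succ_apply]
      exact QbarIter_flat hL j _

/-- `Fbar L 1 Y = Fcoarse L Y` (`BlockAveragePushDirSplit.frameLin_flat`). [folklore] -/
theorem Fbar_flat (L : ℕ) (Y : Site d → Fin d → 𝕄) : Fbar L (flat (d := d) (n := n)) Y = Fcoarse L Y := by
  funext z
  exact frameLin_flat L Y _

/-- `framePotW L j 1 Y = framePot L j Y` — the accumulated frames at the flat background are file (A)'s frame potential. [folklore] -/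
theorem framePotW_flat {L : ℕ} (hL : 1 ≤ L) : ∀ (j : ℕ) (Y : Site d → Fin d → 𝕄), framePotW L j (flat (d := d) (n := n)) Y = framePot L j Y
  | 0, _ => rfl
  | j + 1, Y => by
      funext z
      rw [framePotW_succ', cavgIter_flat, QbarIter_flat hL, Fbar_flat, framePotW_flat hL j]
      rfl

/-- `gaugeDir 1 G = − dPot G`: at the flat background a gauge direction is minus a coboundary, so the structure theorem at `W = 1` reads
`(Tcoarse L)^[j] Y = (Qcoarse L)^[j] Y − dPot (framePot L j Y)` = file (A)'s `NE3TangentFlatStructure.iterate_Tcoarse_eq`. [folklore] -/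
theorem gaugeDir_flat (G : Site d → 𝕄) (x : Site d) (μ : Fin d) : gaugeDir (flat (d := d) (n := n)) G x μ = -dPot G x μ := by
  simp [gaugeDir, flat, Ad, dPot]

end

end Summit.QuantumFields.BalabanUV.T4Continuum.NE3TangentCovariantTower
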